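import Literature.MathematicalPhysics.QuantumFieldTheory.Balaban1983to89.Node00.BetaOfRecord
import Literature.MathematicalPhysics.QuantumFieldTheory.Balaban1983to89.FlowStepBoxExtension
import Literature.MathematicalPhysics.QuantumFieldTheory.Balaban1983to89.BetaPertRigid

/-!
# BalabanUVNodes ∕ N28 — binder B6 «`0 < β̄`, `0 < γc`» AT THE STAGE-8 β OF RECORD `Node00.betaOfMerged βm β⁰ γ`:
# where the two witnesses now live, by name (Track A, DAG node N28 of 28; YM-PLAN v0.12.16 §2d row B6; count-neutral)

HONEST FRAMING.  Count-neutral kernel bookkeeping; NOT a node discharge, not an estimate.  N28 is VACATED in the discharge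
form of record and «closes with B3» (N25 = NODE O).  This module re-homes the provenance of its two positivity witnesses
(`Summits/…/BalabanUVNodesN28SideConditions.lean`, p409032, written against the Stage-5 residual field `D.βfun`) to the
β-FIELD OF RECORD typed on 2026-08-25 (`Node00.BetaOfRecord`, p410806; assembly line of the Stage-8 definer
`βrec := betaOfMerged (betaMerged F 𝓝rec ρ bV) (beta0OfMerged … v₀) θ.γ`): the β of record is
`β_{k+1}(v) := β⁰_{k+1} + 𝟙_{]0,γ]^{k+1}}(v)·(β_merged,k+1(v) − β⁰_{k+1})` — EQUAL to the merged β ON the record box `]0,γ]^{k+1}`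
and to the one-loop number `β⁰_{k+1}` OFF it.  Everything here is elementary (indicator bookkeeping, one `limUnder`, one
right-neighbourhood filter); `βm`, `β⁰`, `γ` are PARAMETERS — nothing of Bałaban's β is asserted.  One finite four-torus
programme at fixed `ε`; nothing continuum ∕ ℝ⁴ ∕ OS ∕ mass-gap ∕ Clay.  0 `def`, 0 `sorry`, standard axioms.

WHAT IS PROVED.
* §1 The β of record AGREES with `β_merged` on every box `]0,γ']^{k+1}`, `γ' ≤ γ`, and equals `β⁰_k` at the zero history; design (α)
  `betaOfTerms` IS the (β)-shape with `βm := β⁰ + β¹`, so every statement below covers both designs of `Node00.BetaOfRecord`.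
* §2 THE `γc`-HALF (binder (B4) + N28's `0 < γc`) at the record.  Every BOX predicate of `FlowStep` is insensitive to the off-box
  convention on boxes INSIDE the record box: `BetaContH` (restriction-and-transport both ways; the one-box `iff` is dag-n26-a's
  `BalabanUVNodesN26Record.betaContH_betaOfMerged_iff`, p411714, cited not restated), `BetaLowerH`, `BetaUpperH` for `γc ≤ γ`; `BetaPertH`,
  `BetaSignH`, `BetaAFH` and the packaged literal binder `T4Continuum.BetaPertHyp` for `γ > 0` — they read `β_merged` ONLY.  Hence N28's
  second witness at the datum of record is `γc := θ.γ` (the record's own box side) or anything smaller: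
  `b4_with_sideCondition_atRecord`.  AND NOT LARGER (kernel negative, `not_betaContH_betaOfMerged_faceJump` ∕
  `exists_printedShape_gammaCap`): for a merged β of the printed shape `β⁰ + O(g_k)` — here `1 + g_k`, continuous everywhere,
  remainder vanishing at `g_k = 0` so that `beta0OfMerged` IS `1` — the β of record is DIScontinuous across the face `g_k = γ`
  of the record box, so `BetaContH γc` FAILS for every `γc > γ > 0`.  CONSEQUENCES (located, for the Stage-8 numerics `θ.γ`, `v₀`
  and the rev-1 crux texts): (a) at a record with `0 < θ.γ` N28's second witness is `θ.γ` or smaller, and IN GENERAL never larger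
  (larger only if `β_merged = β⁰` on the faces `g_i = θ.γ` of the record box) — so a β-side road instantiated at D₀ (the (D4)
  chain's `AtSlopeCont Sβ γ₀ s`, which yields `BetaContH γ₀`; `RemainderConst Sβ γ₀ r`) should take its box `γ₀ ≤ θ.γ`;
  (b) at a record with `θ.γ ≤ 0` the β of record IS the CONSTANT family `β ≡ β⁰` (`betaOfMerged_of_nonpos`) — every box predicate
  then degenerates exactly as in the constant census of `FlowStepBoxExtension` §4: N28's `0 < γc` is, at the record, the guard
  `0 < θ.γ` that keeps the β-field from collapsing to its one-loop numbers (the record-level form of p409032 §2 «`0 < γc` is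
  (B4)'s content guard»).
* §3 THE `β̄`-HALF at the record.  (i) ONE-LOOP RIGIDITY: the printed split `B12Beta.OneLoopSplit` of ANY history family is
  UNIQUE (`oneLoopSplit_unique`), so every `Sβ : OneLoopSplit D₀.βfun` a NODE-O road carries IS the split of record and
  `Sβ.β0 = β⁰` = the `limUnder (𝓝[>] 0)` object `beta0OfMerged` BY NAME (`oneLoopSplit_β0_eq`, `oneLoopSplit_β1_eq`,
  `remainderConst_atRecord_iff`, `merged_eq_beta0_of_zeroRemainder`); (ii) INHERITANCE: if the one-sided limit defining `β⁰_k`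
  exists (`Node00.Beta0LimitExists`, NAMED) and the reference history `v₀` is admissible, every uniform box bound of `β_merged`
  passes to `β⁰_k`; in particular N28's first witness in its asymptotic-freedom currency (`0 < b ≤ β` on a box) gives
  `0 < b ≤ β⁰_k` for EVERY `k` — (AF-0) at the record (`beta0OfMerged_pos_of_betaLowerH`); (iii) under the LITERAL binder (B3)
  the rigidity of `BetaPertRigid` reads, at the record: `BetaPertH D₀.βfun β̄` + vanishing of the remainder ⇒ `β⁰_k = β̄` for every
  `k` (`beta0_eq_betabar_of_literalB3`) — why the literal (B3) is superseded by `EndpointExistence` and N28 is VACATED with it.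
Sources: T. Bałaban, CMP **109** (1987) 249–301 [Balaban1987RG1] (1.22) p. 264 and the sentence after it, (2.12)–(2.14) p. 268,
Thm 2 (0.31) p. 259; CMP **122** (1989) 355–392 [Balaban1989LargeFieldII] Thm 1 p. 355.  Nothing here is a claim about the
Yang–Mills mass gap.
-/

namespace Summit.QuantumFields.YangMills.BalabanUVNodes.N28AtBetaOfRecord

open Literature.MathematicalPhysics.QuantumFieldTheory.Balaban1983to89
open Literature.MathematicalPhysics.QuantumFieldTheory.Balaban1983to89.FlowStep
open Literature.MathematicalPhysics.QuantumFieldTheory.Balaban1983to89.Node00 (betaOfMerged beta0OfMerged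
  oneLoopSplit_betaOfMerged betaOfMerged_of_mem betaOfMerged_of_notMem Beta0LimitExists tendsto_beta0OfMerged
  betaOfTerms beta0OfTerms beta1OfTerms TermFamily0 TermFamily1)
open Literature.MathematicalPhysics.QuantumFieldTheory.Balaban1983to89.T4Continuum (T4Family BetaPertHyp)
open Literature.MathematicalPhysics.QuantumFieldTheory.Balaban1983to89.BetaPertRigid (RemainderVanishes beta0_eq_of_pert)
open Filter Topology

variable {βm : HBeta} {β0 : ℕ → ℝ} {γ : ℝ}

/-! ## §1 The β of record agrees with the merged β on every box inside the record box -/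

/-- On every box `]0,γ']^{k+1}` with `γ' ≤ γ` the β of record IS the merged β (the off-box convention is invisible there).
[cite: Balaban1987RG1, (1.22) p.264] -/
theorem betaOfMerged_eqOn {γ' : ℝ} (hγ : γ' ≤ γ) (k : ℕ) :
    Set.EqOn (betaOfMerged βm β0 γ k) (βm k) (Box γ' k) :=
  fun _ hv => betaOfMerged_of_mem βm β0 γ (box_mono hγ k hv)

/-- At the zero history (off every box) the β of record is the one-loop number `β⁰_k` — the value the clause `vanish` of the
printed split reads. [cite: Balaban1987RG1, (2.12)–(2.14) p.268] -/
theorem betaOfMerged_zeroHist (k : ℕ) : betaOfMerged βm β0 γ k (fun _ => 0) = β0 k :=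
  betaOfMerged_of_notMem βm β0 γ fun h => (lt_irrefl (0 : ℝ)) ((mem_box.mp h) (Fin.last k)).1

section DesignAlpha

variable {𝔄 : Type*} [NormedRing 𝔄] [NormedAlgebra ℝ 𝔄]
variable {V : Type*} [NormedAddCommGroup V] [NormedSpace ℝ V] {ι : Type*} [Fintype ι]

/-- **Design (α) is the (β)-shape.**  The two-term-family β of record `betaOfTerms F ℰ⁰ ℰ¹ ρ bV γ` of `Node00.BetaOfRecord`
IS `betaOfMerged` with merged β `β⁰ + β¹` and one-loop number `β⁰`; so every statement of this module applies to it verbatim.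
[cite: Balaban1987RG1, (1.22) p.264] -/
theorem betaOfTerms_eq_betaOfMerged (F : T4Family) (ℰ0 : TermFamily0 F 𝔄) (ℰ1 : TermFamily1 F 𝔄)
    (ρ : V →L[ℝ] 𝔄) (bV : Module.Basis ι ℝ V) (γ : ℝ) :
    betaOfTerms F ℰ0 ℰ1 ρ bV γ =
      betaOfMerged (fun k w => beta0OfTerms F ℰ0 ρ bV k + beta1OfTerms F ℰ1 ρ bV k w) (beta0OfTerms F ℰ0 ρ bV) γ := by
  funext k v
  simp only [betaOfTerms, betaOfMerged, add_sub_cancel_left]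

end DesignAlpha

/-! ## §2 The `γc`-half: binder (B4) and every box predicate read `β_merged` on boxes inside the record box — and the cap `γc ≤ γ` -/

/-- **(B4) AT THE RECORD, restricted and transported in one step**: joint continuity of the merged β on a box `]0,γ₂]^{k+1}`
gives joint continuity of the β of record on every box `]0,γ₁]^{k+1}` with `γ₁ ≤ γ₂` and `γ₁ ≤ γ` (restriction `ContinuousOn.mono` +
agreement on the box).  The plain `iff` at one box side `γc ≤ γ` is dag-n26-a's `BalabanUVNodesN26Record.betaContH_betaOfMerged_iff`
(p411714) and is not restated here. [cite: Balaban1987RG1, §1 p.264] -/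
theorem betaContH_betaOfMerged_of_le {γ₁ γ₂ : ℝ} (h₁₂ : γ₁ ≤ γ₂) (h₁ : γ₁ ≤ γ) (hC : BetaContH γ₂ βm) :
    BetaContH γ₁ (betaOfMerged βm β0 γ) :=
  fun k => ((hC k).mono (box_mono h₁₂ k)).congr (betaOfMerged_eqOn h₁ k)

/-- … and conversely (`γ₁ ≤ γ₂`, `γ₁ ≤ γ`). [cite: Balaban1987RG1, §1 p.264] -/
theorem betaContH_merged_of_betaOfMerged {γ₁ γ₂ : ℝ} (h₁₂ : γ₁ ≤ γ₂) (h₁ : γ₁ ≤ γ)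
    (hC : BetaContH γ₂ (betaOfMerged βm β0 γ)) : BetaContH γ₁ βm :=
  fun k => ((hC k).mono (box_mono h₁₂ k)).congr fun _ hv => (betaOfMerged_eqOn h₁ k hv).symm

/-- Uniform lower box bounds (the AF currency of `β̄`) at the record are those of the merged β, `γc ≤ γ`. [cite: Balaban1987RG1, Thm 2 (0.31) p.259] -/
theorem betaLowerH_betaOfMerged_iff {γc b : ℝ} (hγ : γc ≤ γ) :
    BetaLowerH b γc (betaOfMerged βm β0 γ) ↔ BetaLowerH b γc βm :=
  ⟨fun h k v hv => by rw [← betaOfMerged_eqOn (βm := βm) (β0 := β0) hγ k hv]; exact h k v hv,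
    fun h k v hv => by rw [betaOfMerged_eqOn (βm := βm) (β0 := β0) hγ k hv]; exact h k v hv⟩

/-- Uniform upper box bounds at the record are those of the merged β, `γc ≤ γ`. [cite: Balaban1987RG1, §1 p.264] -/
theorem betaUpperH_betaOfMerged_iff {γc β' : ℝ} (hγ : γc ≤ γ) :
    BetaUpperH β' γc (betaOfMerged βm β0 γ) ↔ BetaUpperH β' γc βm :=
  ⟨fun h k v hv => by rw [← betaOfMerged_eqOn (βm := βm) (β0 := β0) hγ k hv]; exact h k v hv,
    fun h k v hv => by rw [betaOfMerged_eqOn (βm := βm) (β0 := β0) hγ k hv]; exact h k v hv⟩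

/-- The LITERAL binder (B3) `BetaPertH · β̄` at the record is the same statement about the merged β (shrink its box side to
`min γ₀ γ`), `γ > 0`. [cite: Balaban1989LargeFieldII, Thm 1 p.355] -/
theorem betaPertH_betaOfMerged_iff {βbar : ℝ} (hγ : 0 < γ) :
    BetaPertH (betaOfMerged βm β0 γ) βbar ↔ BetaPertH βm βbar := by
  constructor
  · rintro ⟨γ₀, hγ₀, C, hC, h⟩
    refine ⟨min γ₀ γ, lt_min hγ₀ hγ, C, hC, fun γ₁ hγ₁ hγ₁le k v hv => ?_⟩
    rw [← betaOfMerged_eqOn (βm := βm) (β0 := β0) (hγ₁le.trans (min_le_right _ _)) k hv]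
    exact h γ₁ hγ₁ (hγ₁le.trans (min_le_left _ _)) k v hv
  · rintro ⟨γ₀, hγ₀, C, hC, h⟩
    refine ⟨min γ₀ γ, lt_min hγ₀ hγ, C, hC, fun γ₁ hγ₁ hγ₁le k v hv => ?_⟩
    rw [betaOfMerged_eqOn (βm := βm) (β0 := β0) (hγ₁le.trans (min_le_right _ _)) k hv]
    exact h γ₁ hγ₁ (hγ₁le.trans (min_le_left _ _)) k v hv

/-- The sign typing `BetaSignH` at the record is that of the merged β, `γ > 0`. [cite: Balaban1987RG1, Thm 2 p.259] -/
theorem betaSignH_betaOfMerged_iff (hγ : 0 < γ) : BetaSignH (betaOfMerged βm β0 γ) ↔ BetaSignH βm := by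
  constructor
  · rintro ⟨γ₀, hγ₀, h⟩
    exact ⟨min γ₀ γ, lt_min hγ₀ hγ, (betaLowerH_betaOfMerged_iff (min_le_right _ _)).mp
      fun k v hv => h k v (box_mono (min_le_left _ _) k hv)⟩
  · rintro ⟨γ₀, hγ₀, h⟩
    exact ⟨min γ₀ γ, lt_min hγ₀ hγ, (betaLowerH_betaOfMerged_iff (min_le_right _ _)).mpr
      fun k v hv => h k v (box_mono (min_le_left _ _) k hv)⟩

/-- The asymptotic-freedom typing `BetaAFH` (`0 < b ≤ β` on a box — N28's `β̄` in its pointwise currency) at the record is that of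
the merged β, `γ > 0`. [cite: Balaban1987RG1, Thm 2 (0.31) p.259] -/
theorem betaAFH_betaOfMerged_iff (hγ : 0 < γ) : BetaAFH (betaOfMerged βm β0 γ) ↔ BetaAFH βm := by
  constructor
  · rintro ⟨γ₀, hγ₀, b, hb, h⟩
    exact ⟨min γ₀ γ, lt_min hγ₀ hγ, b, hb, (betaLowerH_betaOfMerged_iff (min_le_right _ _)).mp
      fun k v hv => h k v (box_mono (min_le_left _ _) k hv)⟩
  · rintro ⟨γ₀, hγ₀, b, hb, h⟩
    exact ⟨min γ₀ γ, lt_min hγ₀ hγ, b, hb, (betaLowerH_betaOfMerged_iff (min_le_right _ _)).mpr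
      fun k v hv => h k v (box_mono (min_le_left _ _) k hv)⟩

/-- **N28's LITERAL PAIR AT THE RECORD.**  The packaged literal β-binder of the headline, `T4Continuum.BetaPertHyp`
(= (B3) with `0 < β̄` ∧ (B4) with `0 < γc`), holds for the β of record iff it holds for the merged β — with the (B4)-witness
of the record being `min γc γ ≤ γ`, `γ > 0`. [cite: Balaban1989LargeFieldII, Thm 1 p.355] -/
theorem betaPertHyp_betaOfMerged_iff (hγ : 0 < γ) : BetaPertHyp (betaOfMerged βm β0 γ) ↔ BetaPertHyp βm := by
  constructor
  · rintro ⟨⟨βbar, hβbar, hP⟩, γc, hγc, hC⟩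
    exact ⟨⟨βbar, hβbar, (betaPertH_betaOfMerged_iff hγ).mp hP⟩, min γc γ, lt_min hγc hγ,
      betaContH_merged_of_betaOfMerged (min_le_left _ _) (min_le_right _ _) hC⟩
  · rintro ⟨⟨βbar, hβbar, hP⟩, γc, hγc, hC⟩
    exact ⟨⟨βbar, hβbar, (betaPertH_betaOfMerged_iff hγ).mpr hP⟩, min γc γ, lt_min hγc hγ,
      betaContH_betaOfMerged_of_le (min_le_left _ _) (min_le_right _ _) hC⟩

/-- **WHERE N28's `γc` LIVES AT D₀ (positive half).**  If the merged β is jointly continuous on the record box and the record's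
box side is positive, binder (B4) holds WITH its N28 side condition, the witness being `γc := γ` — the record's own numeric
parameter `θ.γ` (print: «with a sufficiently small positive γ»). [cite: Balaban1989LargeFieldII, Thm 1 p.355] -/
theorem b4_with_sideCondition_atRecord (hγ : 0 < γ) (h : BetaContH γ βm) :
    ∃ γc : ℝ, 0 < γc ∧ BetaContH γc (betaOfMerged βm β0 γ) :=
  ⟨γ, hγ, betaContH_betaOfMerged_of_le le_rfl le_rfl h⟩

/-- **THE GUARD.**  For a NON-POSITIVE record box side the record box is empty and the β of record IS the constant family of
its one-loop numbers, `β_{k+1} ≡ β⁰_{k+1}` — whatever the merged β.  (Then `BetaContH γc` holds for EVERY `γc`, constants being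
continuous, and every β-side clause degenerates as in `FlowStepBoxExtension` §4: the Stage-8 record must carry `0 < θ.γ`.)
[cite: Balaban1987RG1, (1.22) p.264 («defined on the interval [0, γ]»)] -/
theorem betaOfMerged_of_nonpos (hγ : γ ≤ 0) (k : ℕ) (v : Fin (k + 1) → ℝ) : betaOfMerged βm β0 γ k v = β0 k :=
  betaOfMerged_of_notMem βm β0 γ fun h => by
    have h0 := (mem_box.mp h) (Fin.last k)
    linarith [h0.1, h0.2]

/-- … so at such a record binder (B4) is inhabited at EVERY box side `γc` (N28's `0 < γc` carries no content there): the
record-level form of «`0 < γc` is (B4)'s content guard». [cite: Balaban1987RG1, §1 p.264] -/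
theorem betaContH_betaOfMerged_of_nonpos (hγ : γ ≤ 0) (γc : ℝ) : BetaContH γc (betaOfMerged βm β0 γ) := fun k => by
  have h : betaOfMerged βm β0 γ k = fun _ => β0 k := funext (betaOfMerged_of_nonpos hγ k)
  rw [h]
  exact continuousOn_const

/-- **THE CAP (kernel negative).**  For the merged β of the printed shape `β_merged,k+1(v) = 1 + g_k` (one-loop number `1`,
remainder `g_k` vanishing at `g_k = 0`, continuous everywhere) and the record box side `γ > 0`, the β of record is NOT jointly
continuous on any LARGER box `]0,γc]^{k+1}`, `γc > γ`: along the ray `t ↦ (t)` (scale `k = 0`) it jumps from `1 + γ` at `t = γ`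
to `1` for `t > γ`.  So binder (B4)'s `γc` at the record — N28's second witness — can never exceed the record's `θ.γ`.
[cite: Balaban1987RG1, (1.22) p.264 («defined on the interval [0, γ]»)] -/
theorem not_betaContH_betaOfMerged_faceJump {γ γc : ℝ} (hγ : 0 < γ) (hlt : γ < γc) :
    ¬ BetaContH γc (betaOfMerged (fun k v => 1 + v (Fin.last k)) (fun _ => 1) γ) := by
  intro h
  have ha : (fun _ : Fin 1 => γ) ∈ Box γc 0 := mem_box.mpr fun _ => ⟨hγ, hlt.le⟩
  have hr : Continuous fun t : ℝ => (fun _ : Fin 1 => t) := continuous_pi fun _ => continuous_id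
  have hmaps : Set.MapsTo (fun t : ℝ => (fun _ : Fin 1 => t)) (Set.Ioo γ γc) (Box γc 0) :=
    fun t ht => mem_box.mpr fun _ => ⟨hγ.trans ht.1, ht.2.le⟩
  have hcomp :
      ContinuousWithinAt (betaOfMerged (fun k v => 1 + v (Fin.last k)) (fun _ => 1) γ 0 ∘ fun t : ℝ => (fun _ : Fin 1 => t))
        (Set.Ioo γ γc) γ :=
    (h 0 _ ha).comp hr.continuousWithinAt hmaps
  have hfa : betaOfMerged (fun k v => 1 + v (Fin.last k)) (fun _ => 1) γ 0 (fun _ : Fin 1 => γ) = 1 + γ :=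
    betaOfMerged_of_mem _ _ _ (mem_box.mpr fun _ => ⟨hγ, le_rfl⟩)
  have hout : ∀ t ∈ Set.Ioo γ γc,
      (betaOfMerged (fun k v => 1 + v (Fin.last k)) (fun _ => 1) γ 0 ∘ fun t : ℝ => (fun _ : Fin 1 => t)) t = 1 :=
    fun t ht => betaOfMerged_of_notMem _ _ _ fun hm => (not_le.mpr ht.1) ((mem_box.mp hm) 0).2
  have h1 : Tendsto (betaOfMerged (fun k v => 1 + v (Fin.last k)) (fun _ => 1) γ 0 ∘ fun t : ℝ => (fun _ : Fin 1 => t))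
      (𝓝[Set.Ioo γ γc] γ) (𝓝 (1 + γ)) := by
    have ht := hcomp.tendsto
    simp only [Function.comp_apply, hfa] at ht
    exact ht
  have h2 : Tendsto (betaOfMerged (fun k v => 1 + v (Fin.last k)) (fun _ => 1) γ 0 ∘ fun t : ℝ => (fun _ : Fin 1 => t))
      (𝓝[Set.Ioo γ γc] γ) (𝓝 1) :=
    tendsto_const_nhds.congr' (eventually_nhdsWithin_of_forall fun t ht => (hout t ht).symm)
  rw [nhdsWithin_Ioo_eq_nhdsGT hlt] at h1 h2
  have h12 := tendsto_nhds_unique h1 h2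
  linarith

/-- The printed-shape witness is HONEST for the record's `limUnder` object: its one-sided limit as the last coupling `g → 0⁺`
exists at every reference history and `beta0OfMerged` IS `1` (so the β of record of §2's negative is literally
`betaOfMerged βm (beta0OfMerged βm v₀) γ`). [cite: Balaban1987RG1, (2.12)–(2.14) p.268] -/
theorem faceJump_beta0 (v₀ : (k : ℕ) → (Fin (k + 1) → ℝ)) :
    Beta0LimitExists (fun k v => 1 + v (Fin.last k)) v₀ ∧
      beta0OfMerged (fun k v => 1 + v (Fin.last k)) v₀ = fun _ => 1 := by
  have ht : ∀ k : ℕ, Tendsto (fun g : ℝ => (1 : ℝ) + Function.update (v₀ k) (Fin.last k) g (Fin.last k))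
      (𝓝[>] (0 : ℝ)) (𝓝 1) := fun k => by
    simp only [Function.update_self]
    have hc : Tendsto (fun g : ℝ => (1 : ℝ) + g) (𝓝 (0 : ℝ)) (𝓝 ((1 : ℝ) + 0)) :=
      ((continuous_const.add continuous_id).tendsto 0)
    rw [add_zero] at hc
    exact hc.mono_left nhdsWithin_le_nhds
  refine ⟨fun k => ⟨1, ht k⟩, funext fun k => ?_⟩
  unfold beta0OfMerged
  exact (ht k).limUnder_eq

/-- **WHERE N28's `γc` LIVES AT D₀ (the cap, packaged).**  For every record box side `γ > 0` and every `γc > γ` there is a merged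
β of the printed shape — jointly continuous on EVERY box, with an honest one-loop number (`Beta0LimitExists`, `β⁰ ≡ 1` as the
`g_k → 0⁺` limit) — whose β of record violates `BetaContH γc`.  Hence at the datum of record N28's `γc` is the record's `θ.γ`
(or smaller) and in general nothing larger; a β-side road over `D₀.βfun` (e.g. the (D4) chain's `AtSlopeCont Sβ γ₀ s`, which
yields `BetaContH γ₀`) should take its box `γ₀ ≤ θ.γ`. [cite: Balaban1987RG1, (1.22) p.264] -/
theorem exists_printedShape_gammaCap {γ γc : ℝ} (hγ : 0 < γ) (hlt : γ < γc) :
    ∃ βm : HBeta, (∀ γ' : ℝ, BetaContH γ' βm) ∧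
      (∀ v₀, Beta0LimitExists βm v₀ ∧ beta0OfMerged βm v₀ = fun _ => 1) ∧
      ∀ v₀, ¬ BetaContH γc (betaOfMerged βm (beta0OfMerged βm v₀) γ) := by
  refine ⟨fun k v => 1 + v (Fin.last k), fun γ' k => ?_, faceJump_beta0, fun v₀ => ?_⟩
  · exact (continuous_const.add (continuous_apply (Fin.last k))).continuousOn
  · rw [(faceJump_beta0 v₀).2]
    exact not_betaContH_betaOfMerged_faceJump hγ hlt

/-! ## §3 The `β̄`-half: one-loop rigidity at the record, inheritance of box bounds by `β⁰`, and the literal (B3) -/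

/-- **THE PRINTED ONE-LOOP SPLIT IS UNIQUE** (for ANY history family): `β⁰_k = β_k(0,…,0)` by the clause `vanish` read at the
zero history, and then `β¹ = β − β⁰` by `split`.  So a NODE-O road's `Sβ : OneLoopSplit D₀.βfun` is never a choice.
[cite: Balaban1987RG1, (2.12)–(2.14) p.268] -/
theorem oneLoopSplit_unique {β : HBeta} : ∀ S S' : B12Beta.OneLoopSplit β, S = S'
  | ⟨a, b, hs, hv⟩, ⟨a', b', hs', hv'⟩ => by
    have h0 : a = a' := by
      funext k
      have e1 := hs k (fun _ => 0)
      have e2 := hs' k (fun _ => 0)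
      rw [hv k _ rfl, add_zero] at e1
      rw [hv' k _ rfl, add_zero] at e2
      rw [← e1, ← e2]
    subst h0
    have h1 : b = b' := by
      funext k v
      have e1 := hs k v
      have e2 := hs' k v
      linarith
    subst h1
    rfl

/-- **At the record every split carries THE one-loop number of record**: `Sβ.β0 = β⁰` (= the `limUnder (𝓝[>] 0)` object
`Node00.beta0OfMerged …` in the definer's assembly) for EVERY `Sβ : OneLoopSplit (betaOfMerged βm β⁰ γ)`.  So each NODE-O
hypothesis on `Sβ.β0` ((AF-0) positivity, the (AF-0r) tail `|Sβ.β0 k − β⁰_∞| ≤ c₀θ^k`, `r ≤ β⁰_∞∕4`, the drift slope) — the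
`β̄`-half of N28 in the END currencies — is a statement about that named object. [cite: Balaban1987RG1, (2.12)–(2.14) p.268] -/
theorem oneLoopSplit_β0_eq (S : B12Beta.OneLoopSplit (betaOfMerged βm β0 γ)) (k : ℕ) : S.β0 k = β0 k := by
  have h := oneLoopSplit_unique S (oneLoopSplit_betaOfMerged βm β0 γ)
  subst h
  rfl

/-- … and the remainder of every split at the record is the boxed remainder `𝟙_{]0,γ]^{k+1}}·(β_merged − β⁰)`.
[cite: Balaban1987RG1, (2.12)–(2.14) p.268] -/
theorem oneLoopSplit_β1_eq (S : B12Beta.OneLoopSplit (betaOfMerged βm β0 γ)) (k : ℕ) (v : Fin (k + 1) → ℝ) :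
    S.β1 k v = (Box γ k).indicator (fun w => βm k w - β0 k) v := by
  have h := oneLoopSplit_unique S (oneLoopSplit_betaOfMerged βm β0 γ)
  subst h
  rfl

/-- **The remainder wall input at the record.**  For every split of the β of record and every box `]0,γ']^{k+1}` inside the record
box, the constant-form remainder bound `Beta.RemainderChain.RemainderConst Sβ γ' r` (the B12-Thm-2 sub-DAG's wall input, BC3's
`stub_oneLoopLawAtRecord`) IS `|β_merged,k+1(p) − β⁰_{k+1}| ≤ r` on those boxes. [cite: Balaban1987RG1, Thm 2 p.259] -/
theorem remainderConst_atRecord_iff (S : B12Beta.OneLoopSplit (betaOfMerged βm β0 γ)) {γ' r : ℝ} (hγ : γ' ≤ γ) :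
    Beta.RemainderChain.RemainderConst S γ' r ↔ ∀ k p, p ∈ B12Beta.HistBox γ' k → |βm k p - β0 k| ≤ r := by
  have key : ∀ k p, p ∈ B12Beta.HistBox γ' k → S.β1 k p = βm k p - β0 k := fun k p hp => by
    rw [oneLoopSplit_β1_eq S k p, Set.indicator_of_mem (box_mono hγ k ((histBox_eq_box γ' k) ▸ hp))]
  exact ⟨fun h k p hp => by rw [← key k p hp]; exact h k p hp, fun h k p hp => by rw [key k p hp]; exact h k p hp⟩

/-- **The zero-activity witness at the record, unmasked.**  If some (hence THE, `oneLoopSplit_unique`) split of the β of record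
has zero remainder on a box `]0,γ']^{k+1}`, `γ' ≤ γ` — the «zero-activity witness in disguise» of the discharge referee's (D4)
read card — then the merged β IS the constant one-loop number there: `β_merged,k+1 ≡ β⁰_{k+1}` on that box.  So once `β_merged`
is pinned to Bałaban's, a zero-remainder split exists only if his remainder (2.13) vanishes identically on the box.
[cite: Balaban1987RG1, (2.13) p.268] -/
theorem merged_eq_beta0_of_zeroRemainder (S : B12Beta.OneLoopSplit (betaOfMerged βm β0 γ)) {γ' : ℝ} (hγ : γ' ≤ γ)
    (h0 : ∀ k p, p ∈ Box γ' k → S.β1 k p = 0) {k : ℕ} {p : Fin (k + 1) → ℝ} (hp : p ∈ Box γ' k) :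
    βm k p = β0 k := by
  have h := h0 k p hp
  rw [oneLoopSplit_β1_eq S k p, Set.indicator_of_mem (box_mono hγ k hp)] at h
  simpa [sub_eq_zero] using h

section Inheritance

variable {v₀ : (k : ℕ) → (Fin (k + 1) → ℝ)}

/-- **INHERITANCE (lower).**  If the one-sided limit defining `β⁰_k` exists (`Node00.Beta0LimitExists`, NAMED, never asserted) at
a reference history `v₀` whose first `k` entries are admissible (`∈ ]0,γ']`), every uniform LOWER box bound `b ≤ β_merged` on
`]0,γ']^{k+1}` passes to the one-loop number of record: `b ≤ β⁰_k`. [cite: Balaban1987RG1, Thm 2 (0.31) p.259] -/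
theorem le_beta0OfMerged_of_betaLowerH (hlim : Beta0LimitExists βm v₀) {b γ' : ℝ} (hγ' : 0 < γ')
    (hv₀ : ∀ k (i : Fin (k + 1)), i ≠ Fin.last k → 0 < v₀ k i ∧ v₀ k i ≤ γ') (hlo : BetaLowerH b γ' βm) (k : ℕ) :
    b ≤ beta0OfMerged βm v₀ k := by
  refine ge_of_tendsto (tendsto_beta0OfMerged βm v₀ hlim k) ?_
  filter_upwards [Ioc_mem_nhdsGT hγ'] with g hg
  refine hlo k _ (mem_box.mpr fun i => ?_)
  by_cases hi : i = Fin.last k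
  · subst hi
    simpa only [Function.update_self, Set.mem_Ioc] using hg
  · rw [Function.update_of_ne hi]
    exact hv₀ k i hi

/-- **INHERITANCE (upper).**  Same for uniform UPPER box bounds: `β_merged ≤ β'` on `]0,γ']^{k+1}` ⇒ `β⁰_k ≤ β'`.
[cite: Balaban1987RG1, §1 p.264 («uniformly bounded on this interval»)] -/
theorem beta0OfMerged_le_of_betaUpperH (hlim : Beta0LimitExists βm v₀) {β' γ' : ℝ} (hγ' : 0 < γ')
    (hv₀ : ∀ k (i : Fin (k + 1)), i ≠ Fin.last k → 0 < v₀ k i ∧ v₀ k i ≤ γ') (hup : BetaUpperH β' γ' βm) (k : ℕ) :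
    beta0OfMerged βm v₀ k ≤ β' := by
  refine le_of_tendsto (tendsto_beta0OfMerged βm v₀ hlim k) ?_
  filter_upwards [Ioc_mem_nhdsGT hγ'] with g hg
  refine hup k _ (mem_box.mpr fun i => ?_)
  by_cases hi : i = Fin.last k
  · subst hi
    simpa only [Function.update_self, Set.mem_Ioc] using hg
  · rw [Function.update_of_ne hi]
    exact hv₀ k i hi

/-- **N28's `β̄` BECOMES (AF-0) AT THE RECORD.**  A uniform asymptotic-freedom bound `0 < b ≤ β_merged` on a box containing the
admissible reference history, together with the existence of the one-sided limit, gives the POSITIVITY OF EVERY ONE-LOOP NUMBER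
OF RECORD, `0 < b ≤ β⁰_k` — the `β̄`-half of N28 in the currency the NODE-O roads consume (`Sβ.β0`, §3 (i)).  Hypotheses, not
facts: nothing of the kind is printed for Bałaban's β ([Balaban1989LargeFieldII] p. 355 «has not been published yet»).
[cite: Balaban1989LargeFieldII, Thm 1 p.355] -/
theorem beta0OfMerged_pos_of_betaLowerH (hlim : Beta0LimitExists βm v₀) {b γ' : ℝ} (hγ' : 0 < γ') (hb : 0 < b)
    (hv₀ : ∀ k (i : Fin (k + 1)), i ≠ Fin.last k → 0 < v₀ k i ∧ v₀ k i ≤ γ') (hlo : BetaLowerH b γ' βm) (k : ℕ) :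
    0 < beta0OfMerged βm v₀ k :=
  hb.trans_le (le_beta0OfMerged_of_betaLowerH hlim hγ' hv₀ hlo k)

/-- The constant reference history `(γ', …, γ')` is admissible for the inheritance lemmas (a located choice for the numeric `v₀`;
any history inside the record box works). [cite: Balaban1987RG1, §1 p.264] -/
theorem constHist_admissible {γ' : ℝ} (hγ' : 0 < γ') :
    ∀ k (i : Fin (k + 1)), i ≠ Fin.last k → 0 < (fun (k : ℕ) (_ : Fin (k + 1)) => γ') k i ∧
      (fun (k : ℕ) (_ : Fin (k + 1)) => γ') k i ≤ γ' :=
  fun _ _ _ => ⟨hγ', le_rfl⟩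

end Inheritance

/-- **THE LITERAL (B3) AT THE RECORD IS RIGID.**  If the remainder of the split of record vanishes along the diagonal as `g → 0⁺`
(`BetaPertRigid.RemainderVanishes`, the weakest quantitative reading of p. 268) and the LITERAL binder (B3) `BetaPertH D₀.βfun β̄`
holds, then `β⁰_k = β̄` for EVERY `k`: N28's `β̄` would have to BE the (hence `k`-independent) one-loop number of record.  This is
`BetaPertRigid.beta0_eq_of_pert` read at the record through §3 (i); it is why the literal (B3) is superseded by
`DagBinding.EndpointExistence` and N28 is VACATED with it. [cite: Balaban1989LargeFieldII, Thm 1 p.355] -/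
theorem beta0_eq_betabar_of_literalB3 (hrem : RemainderVanishes (oneLoopSplit_betaOfMerged βm β0 γ)) {βbar : ℝ}
    (hP : BetaPertH (betaOfMerged βm β0 γ) βbar) (k : ℕ) : β0 k = βbar :=
  beta0_eq_of_pert (oneLoopSplit_betaOfMerged βm β0 γ) hrem hP k

/-- `RemainderVanishes` for the split of record, unfolded: the merged β tends to the one-loop number along the diagonal
`(g,…,g)`, `g → 0⁺` (for `g ≤ γ` the diagonal history is in the record box). [cite: Balaban1987RG1, (2.12)–(2.14) p.268] -/
theorem remainderVanishes_atRecord_iff (hγ : 0 < γ) :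
    RemainderVanishes (oneLoopSplit_betaOfMerged βm β0 γ) ↔
      ∀ k : ℕ, ∀ ε : ℝ, 0 < ε → ∃ δ : ℝ, 0 < δ ∧ ∀ g : ℝ, 0 < g → g < δ → |βm k (fun _ => g) - β0 k| ≤ ε := by
  have key : ∀ k (g : ℝ), 0 < g → g ≤ γ →
      (oneLoopSplit_betaOfMerged βm β0 γ).β1 k (fun _ => g) = βm k (fun _ => g) - β0 k := fun k g hg hgγ => by
    show (Box γ k).indicator (fun w => βm k w - β0 k) (fun _ => g) = _
    rw [Set.indicator_of_mem (mem_box.mpr fun _ => ⟨hg, hgγ⟩)]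
  constructor
  · intro h k ε hε
    obtain ⟨δ, hδ, hδε⟩ := h k ε hε
    refine ⟨min δ γ, lt_min hδ hγ, fun g hg hgδ => ?_⟩
    rw [← key k g hg (hgδ.le.trans (min_le_right _ _))]
    exact hδε g hg (lt_of_lt_of_le hgδ (min_le_left _ _))
  · intro h k ε hε
    obtain ⟨δ, hδ, hδε⟩ := h k ε hε
    refine ⟨min δ γ, lt_min hδ hγ, fun g hg hgδ => ?_⟩
    rw [key k g hg (hgδ.le.trans (min_le_right _ _))]
    exact hδε g hg (lt_of_lt_of_le hgδ (min_le_left _ _))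

end Summit.QuantumFields.YangMills.BalabanUVNodes.N28AtBetaOfRecord
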